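import Literature.InformationTheory.QuantumCodes.IrreducibleClusters
import Literature.InformationTheory.QuantumCodes.LDPCCountingThreshold
import Literature.InformationTheory.QuantumCodes.PathCountingBound
import HarnessLib

/-!
# The code-capacity threshold of CSS LDPC codes under minimum-weight decoding with the
# irreducible-cluster count: `2(w-1)√(p(1-p)) < 1` (Dumer–Kovalev–Pryadko 2015, Theorem 2 at `y = 0`)

Topic `Literature/InformationTheory/QuantumCodes` (venture QEC, LADDER-QEC rung Q5; qec-lit-2). PROVED, no
named fact, kernel axioms. This file upgrades the CONSTANT of the tree's counting-bound threshold for one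
error type of a CSS (or classical) LDPC code under ANY minimum-weight decoder (`LDPCCountingThreshold.lean`,
Kovalev–Pryadko 2013 Thm. 3 / Gottesman 2014 Thm. 3 with the lattice-animal constant: `2Δ²√p < 1`, `Δ` the
degree of the check graph, e.g. `Δ = c(w-1)`) to the constant PRINTED by Dumer–Kovalev–Pryadko: only the CHECK
WEIGHT `w` enters, through their count `N_m ≤ n (w-1)^{m-1}` of irreducible undetectable operators
(`IrreducibleClusters.lean`), and the column weight disappears.

**Printed statement** (DKP15 Thm. 2 at `y = 0`, one error type): "Any sequence of CSS codes [`d ≥ D ln n`]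
with generator weights not exceeding `w_X`, `w_Z` can be decoded with vanishing error probabilities if …
`(w_X - 1) Υ_CSS(0, p_Z) ≤ e^{-1/D}`, `(w_Z - 1) Υ_CSS(0, p_X) ≤ e^{-1/D}`, where
`Υ_CSS(y, p) = y + 2(1-y)[p(1-p)]^{1/2}`" — i.e. `2(w-1)√(p(1-p)) < 1` for power-law distance. Mechanism
(p. 4, eqs. (min-E-condition)–(succesful-decoding)): let `E` be the error and `E'` "the same-syndrome Pauli
operator which minimizes the energy" (= weight); "`E'E†` is undetectable … [Lemma 4] gives a decomposition
… into irreducible undetectable operators … `E'` is correct iff `E'E†` is trivial … Otherwise, there is an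
irreducible operator `U ∈ 𝒰` which does not increase the energy of the original error `E`", i.e. (for
independent single-type errors) at least half of the qubits of `U` are in error — the tree's half-weight
lemma `card_le_two_mul_card_inter_of_minWeight` — and `P[E ∈ ℬ(U)] ≤ (2√(p(1-p)))^{wgt U}` (the tree's
`sum_bernoulliWeight_halfDense_le`, Dennis et al. eq. (27)); sum over `U` with `N_m ≤ n(w-1)^{m-1}`.

**Typed statements** (Fin-indexed, in the vocabulary of `LDPCCountingThreshold.lean`: `IsMinWeightDecoder`,
`DecodingFails H SX D E`, so that the Summits-side packaging `cssFailureFamily` applies verbatim):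
* `exists_irreducible_of_decodingFails` — failure ⇒ an irreducible `U` with `𝟙_U ∉ SX` (so `|U| ≥ d`) and
  `|U| ≤ 2 |U ∩ E|`;
* `sum_pow_card_irreducible_le` — the counting core `Σ_{U irreducible, |U| ≥ d} θ^{|U|} ≤ n (Kθ)^d/(K(1-Kθ))`,
  `K = w-1`, for any `0 ≤ θ` with `Kθ < 1`;
* `sum_decodingFails_le_of_rowWeight` — LOCALLY STOCHASTIC noise of parameter `p`: with `r := 2(w-1)√p < 1`,
  `Σ_{E fails} μ E ≤ n r^d / ((w-1)(1-r))` (threshold `p < 1/(4(w-1)²)`; Gottesman 2014's printed local-stochastic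
  constant is `(2ze)⁻²` with `z = c(w-1)`, weaker);
* `sum_decodingFails_bernoulli_le_of_rowWeight` — INDEPENDENT errors of rate `p ≤ 1/2`: with
  `r := 2(w-1)√(p(1-p)) < 1`, the same bound (threshold `4(w-1)² p(1-p) < 1`, the printed condition);
* `cssCodeCapacityThreshold_of_rowWeight` — family form: subexponential family (`n_i r^{d_i} → 0`, `0 < r < 1`)
  ⇒ failure probability `→ 0` for every `0 ≤ p ≤ 1/2` with `4(w-1)² p(1-p) < 1`.
Numbers (no theorem claims them; arithmetic of the hypothesis): toric code `w = 4`: `p(1-p) < 1/36`, i.e.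
`p < (3-2√2)/6 ≈ .0286` — DKLP's elementary value, now for EVERY weight-4 CSS family and by a third route;
check weight `6` (the bivariate-bicycle / gross-code class): `p(1-p) < 1/100`, i.e. `p < .0101`, versus
`(2·15²)⁻² ≈ 4.9·10⁻⁶` from the animal bound with `Δ = 3·5`. The printed `p_{Zc}^* ≈ 0.029` for the toric code
(DKP15 p. 5) is this bound.

## References

* [DumerKovalevPryadko2015] I. Dumer, A. A. Kovalev, L. P. Pryadko, PRL 115 (2015) 050502, arXiv:1412.6172
  (held `paper:arxiv-1412.6172`): Thm. 2 and `Υ_CSS` (chunk p0003 L96–110), min-energy decoding and the bad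
  events `ℬ(U)`, eqs. (min-E-condition), (succesful-decoding) (p0004 L15–66), eq. (upper-bound-Nm-CSS)
  (p0005 L26–33), toric `p_{Zc}^* ≈ 0.029` (p0006 L37–41).
* [Gottesman2014] D. Gottesman, QIC 14 (2014) 1338, arXiv:1310.2984, §4 Thm. 3 (local stochastic noise,
  minimum-weight decoding; constant `(2ze)⁻²`).
* [KovalevPryadko2013] A. A. Kovalev, L. P. Pryadko, PRA 87 (2013) 020304(R), Thm. 3.
* [DennisEtAl2002] Dennis–Kitaev–Landahl–Preskill, J. Math. Phys. 43 (2002) 4452, §5.2 eq. (27)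
  (`(4p(1-p))^{H/2}` per path) — the tree's `PathCountingBound.lean`.
-/

namespace Literature.InformationTheory.QuantumCodes

open Finset Matrix Filter Topology

/-! ### The counting core: `Σ_{U irreducible, |U| ≥ d} θ^{|U|}` -/

section Counting

variable {ι V : Type*} [Fintype V] [DecidableEq V]

/-- **Summing a per-operator bound over the irreducible operators** (the step from eq. (succesful-decoding)
to eq. (aux-sum)): if checks have weight `≤ w` (`w ≥ 2`, `K := w-1`) and every irreducible operator of size
`m` contributes `θ^m` (`θ ≥ 0`, `Kθ < 1`), then, grading by `m ≥ d ≥ 1` and using `N_m ≤ |V| K^{m-1}`,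
`Σ_{U irreducible, |U| ≥ d} θ^{|U|} ≤ (|V|/K) Σ_{m ≥ d} (Kθ)^m ≤ |V| (Kθ)^d / (K (1 - Kθ))`.
[cite: DumerKovalevPryadko2015, eq. (aux-sum) (with 3n[2(w-1)]^{m-1} replaced by n(w-1)^{m-1} for one error type)] -/
theorem sum_pow_card_irreducible_le (H : Matrix ι V (ZMod 2)) {w : ℕ} (hw : 2 ≤ w)
    (hrow : ∀ i, (rowSupp H i).card ≤ w) {d : ℕ} (hd1 : 1 ≤ d) {θ : ℝ} (hθ0 : 0 ≤ θ)
    (hr : ((w - 1 : ℕ) : ℝ) * θ < 1) [DecidablePred (IsIrreducible H)] :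
    ∑ W ∈ univ.filter (fun W : Finset V => IsIrreducible H W ∧ d ≤ W.card), θ ^ W.card ≤
      (Fintype.card V : ℝ) * (((w - 1 : ℕ) : ℝ) * θ) ^ d /
        (((w - 1 : ℕ) : ℝ) * (1 - ((w - 1 : ℕ) : ℝ) * θ)) := by
  classical
  set K : ℝ := ((w - 1 : ℕ) : ℝ) with hK
  set r : ℝ := K * θ with hrdef
  have hK1 : 1 ≤ K := by
    rw [hK]
    exact_mod_cast (show 1 ≤ w - 1 by omega)
  have hK0 : 0 < K := by linarith
  have hr0 : 0 ≤ r := by positivity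
  have h1r : 0 < 1 - r := by linarith
  set n : ℕ := Fintype.card V with hn
  set Ps : Finset (Finset V) := univ.filter (fun W => IsIrreducible H W ∧ d ≤ W.card) with hPs
  -- grade the family by the size `m ∈ [d, |V|]`
  have hmaps : ∀ W ∈ Ps, W.card ∈ Finset.Ico d (n + 1) := by
    intro W hW
    rw [hPs, mem_filter] at hW
    rw [Finset.mem_Ico]
    exact ⟨hW.2.2, Nat.lt_succ_of_le (card_le_univ W)⟩
  have h2 : ∑ W ∈ Ps, θ ^ W.card =
      ∑ m ∈ Finset.Ico d (n + 1), ∑ W ∈ Ps.filter (fun W => W.card = m), θ ^ W.card :=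
    (Finset.sum_fiberwise_of_maps_to hmaps _).symm
  -- each fibre has at most `N_m ≤ n (w-1)^{m-1}` members
  have hfiber : ∀ m ∈ Finset.Ico d (n + 1),
      ∑ W ∈ Ps.filter (fun W => W.card = m), θ ^ W.card ≤ (n : ℝ) * K ^ (m - 1) * θ ^ m := by
    intro m _
    have hcount : ((Ps.filter (fun W => W.card = m)).card : ℝ) ≤ (n : ℝ) * K ^ (m - 1) := by
      have hsub : Ps.filter (fun W => W.card = m) ⊆
          univ.filter (fun U : Finset V => IsIrreducible H U ∧ U.card = m) := by
        intro W hW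
        rw [mem_filter, hPs, mem_filter] at hW
        rw [mem_filter]
        exact ⟨mem_univ _, hW.1.2.1, hW.2⟩
      have hc := (card_le_card hsub).trans (card_irreducible_le H hrow m)
      have hc' : ((Ps.filter (fun W => W.card = m)).card : ℝ) ≤ ((n * (w - 1) ^ (m - 1) : ℕ) : ℝ) := by
        exact_mod_cast hc
      rw [hK]
      push_cast at hc' ⊢
      exact hc'
    calc ∑ W ∈ Ps.filter (fun W => W.card = m), θ ^ W.card
        = ∑ W ∈ Ps.filter (fun W => W.card = m), θ ^ m :=
          Finset.sum_congr rfl fun W hW => by rw [(Finset.mem_filter.1 hW).2]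
      _ = ((Ps.filter (fun W => W.card = m)).card : ℝ) * θ ^ m := by
          rw [Finset.sum_const, nsmul_eq_mul]
      _ ≤ (n : ℝ) * K ^ (m - 1) * θ ^ m :=
          mul_le_mul_of_nonneg_right hcount (pow_nonneg hθ0 _)
  -- the geometric tail
  have hterm : ∀ m ∈ Finset.Ico d (n + 1), (n : ℝ) * K ^ (m - 1) * θ ^ m = (n : ℝ) / K * r ^ m := by
    intro m hm
    have hm1 : 1 ≤ m := le_trans hd1 (Finset.mem_Ico.1 hm).1
    obtain ⟨m', rfl⟩ : ∃ m', m = m' + 1 := ⟨m - 1, by omega⟩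
    simp only [Nat.add_sub_cancel, hrdef]
    field_simp
    ring
  have h3 : ∑ m ∈ Finset.Ico d (n + 1), (n : ℝ) * K ^ (m - 1) * θ ^ m =
      (n : ℝ) / K * ∑ m ∈ Finset.Ico d (n + 1), r ^ m := by
    rw [Finset.mul_sum]
    exact Finset.sum_congr rfl hterm
  have hgeom := geom_tail_le hr0 hr d (n + 1)
  calc ∑ W ∈ Ps, θ ^ W.card
      = ∑ m ∈ Finset.Ico d (n + 1), ∑ W ∈ Ps.filter (fun W => W.card = m), θ ^ W.card := h2
    _ ≤ ∑ m ∈ Finset.Ico d (n + 1), (n : ℝ) * K ^ (m - 1) * θ ^ m := Finset.sum_le_sum hfiber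
    _ = (n : ℝ) / K * ∑ m ∈ Finset.Ico d (n + 1), r ^ m := h3
    _ ≤ (n : ℝ) / K * (r ^ d / (1 - r)) := mul_le_mul_of_nonneg_left hgeom (by positivity)
    _ = (n : ℝ) * r ^ d / (K * (1 - r)) := by
        field_simp

omit [DecidableEq V] in
/-- Sums over a union of events are at most the sum of the sums (nonnegative weights). [folklore] -/
private theorem sum_le_sum_sum_of_cover {α : Type*} {μ : Finset V → ℝ} (hnn : ∀ E, 0 ≤ μ E)
    (Ps : Finset α) (P : α → Finset V → Prop) [∀ a, DecidablePred (P a)] (Bad : Finset (Finset V))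
    (hcover : ∀ E ∈ Bad, ∃ a ∈ Ps, P a E) :
    ∑ E ∈ Bad, μ E ≤ ∑ a ∈ Ps, ∑ E ∈ univ.filter (fun E => P a E), μ E := by
  classical
  calc ∑ E ∈ Bad, μ E
      ≤ ∑ E ∈ Bad, ∑ a ∈ Ps, (if P a E then μ E else 0) := by
        refine Finset.sum_le_sum fun E hE => ?_
        obtain ⟨a, ha, haE⟩ := hcover E hE
        calc μ E = (if P a E then μ E else 0) := by rw [if_pos haE]
          _ ≤ ∑ a ∈ Ps, (if P a E then μ E else 0) :=
              Finset.single_le_sum (f := fun a => if P a E then μ E else 0)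
                (fun b _ => by split_ifs <;> simp [hnn E]) ha
    _ = ∑ a ∈ Ps, ∑ E ∈ Bad, (if P a E then μ E else 0) := Finset.sum_comm
    _ ≤ ∑ a ∈ Ps, ∑ E, (if P a E then μ E else 0) := by
        refine Finset.sum_le_sum fun a _ => ?_
        exact Finset.sum_le_sum_of_subset_of_nonneg (Finset.subset_univ _)
          (fun E _ _ => by split_ifs <;> simp [hnn E])
    _ = ∑ a ∈ Ps, ∑ E ∈ univ.filter (fun E => P a E), μ E := by
        refine Finset.sum_congr rfl fun a _ => ?_
        rw [Finset.sum_filter]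

/-- **Union bound for half-dense covering events under a locally stochastic law**: if every `E ∈ Bad` has
at least half of some member `T a` (`a ∈ Ps`) faulty, then `Σ_{E ∈ Bad} μ E ≤ Σ_{a ∈ Ps} (2√p)^{|T a|}`
(the tree's `sum_filter_dense_le` per member: "the probability of having at least `⌈s/2⌉` errors in `S` is at
most `2^s p^{s/2}`"). [cite: Gottesman2014, Thm 3 (proof: 2^s p^{s/2}, summed over clusters)] -/
theorem IsLocallyStochastic.sum_le_sum_of_halfDense_cover {μ : Finset V → ℝ} {p : ℝ}
    (hμ : IsLocallyStochastic μ p) (hp0 : 0 ≤ p) (hp1 : p ≤ 1) {α : Type*} (Ps : Finset α)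
    (T : α → Finset V) (Bad : Finset (Finset V))
    (hcover : ∀ E ∈ Bad, ∃ a ∈ Ps, (T a).card ≤ 2 * (T a ∩ E).card) :
    ∑ E ∈ Bad, μ E ≤ ∑ a ∈ Ps, (2 * Real.sqrt p) ^ (T a).card := by
  classical
  refine (sum_le_sum_sum_of_cover hμ.nonneg Ps (fun a E => (T a).card ≤ 2 * (T a ∩ E).card) Bad
    hcover).trans ?_
  exact Finset.sum_le_sum fun a _ => sum_filter_dense_le hμ hp0 hp1 (T a)

end Counting

/-! ### Failure of minimum-weight decoding forces a half-faulty irreducible operator -/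

section Decoding

variable {m n : ℕ}

/-- The tree's `errorVec` (`LDPCCountingThreshold.lean`) is the indicator `vecOf` at `V = Fin n`.
[cite: DumerKovalevPryadko2015, p. 3 (operators composed only of Z)] -/
theorem errorVec_eq_vecOf (E : Finset (Fin n)) : errorVec E = vecOf E := rfl

/-- On a subset of its support, a binary vector restricts to the indicator: `x|_A = 𝟙_A` for `A ⊆ supp x`.
[cite: DumerKovalevPryadko2015, p. 3 (operators composed only of Z)] -/
theorem restrictTo_eq_vecOf {x : Fin n → ZMod 2} {A : Finset (Fin n)} (hA : A ⊆ supp x) :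
    restrictTo A x = vecOf A := by
  funext i
  by_cases hi : i ∈ A
  · rw [restrictTo_apply_of_mem hi, vecOf_apply_of_mem hi]
    have hx : x i ≠ 0 := by
      have := hA hi
      simp only [supp, mem_filter, mem_univ, true_and] at this
      exact this
    revert hx
    generalize x i = a
    decide +revert
  · rw [restrictTo_apply_of_not_mem hi, vecOf_apply_of_not_mem hi]

/-- **DKP15's failure criterion for minimum-weight decoding** (one error type): if a minimum-weight decoder
fails on the error set `E`, then some IRREDUCIBLE undetectable operator `U` with `𝟙_U ∉ SX` (hence `|U| ≥ d`)
"does not increase the energy of the original error", i.e. at least half of its qubits are in error: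
`|U| ≤ 2 |U ∩ E|`. (Lemma 4 applied to `E + E'`, then the half-weight lemma
`card_le_two_mul_card_inter_of_minWeight`.) [cite: DumerKovalevPryadko2015, eq. (min-E-condition) (bad events ℬ(U))] -/
theorem exists_irreducible_of_decodingFails (H : Matrix (Fin m) (Fin n) (ZMod 2))
    (SX : Submodule (ZMod 2) (Fin n → ZMod 2)) {D : (Fin m → ZMod 2) → (Fin n → ZMod 2)}
    (hD : IsMinWeightDecoder H D) {E : Finset (Fin n)} (hE : DecodingFails H SX D E) :
    ∃ W : Finset (Fin n), IsIrreducible H W ∧ vecOf W ∉ SX ∧ W.card ≤ 2 * (W ∩ E).card := by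
  classical
  have hsyn : H *ᵥ D (H *ᵥ errorVec E) = H *ᵥ errorVec E := (hD (errorVec E)).1
  have hmin : ∀ x : Fin n → ZMod 2, H *ᵥ x = H *ᵥ errorVec E →
      hammingNorm (D (H *ᵥ errorVec E)) ≤ hammingNorm x := (hD (errorVec E)).2
  have hx : H *ᵥ (errorVec E + D (H *ᵥ errorVec E)) = 0 := by
    rw [Matrix.mulVec_add, hsyn]
    funext i
    exact CharTwo.add_self_eq_zero _
  obtain ⟨W, hWsub, hirr, hWS⟩ := exists_irreducible_of_mulVec_eq_zero H SX hx hE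
  refine ⟨W, hirr, hWS, ?_⟩
  have hDA : H *ᵥ restrictTo W (errorVec E + D (H *ᵥ errorVec E)) = 0 := by
    rw [restrictTo_eq_vecOf hWsub]
    exact hirr.undetectable
  have h := card_le_two_mul_card_inter_of_minWeight H hsyn hmin hWsub hDA
  rwa [errorVec_eq_vecOf, supp_vecOf] at h

/-- **Counting-bound threshold with the irreducible-cluster constant, finite length, LOCALLY STOCHASTIC
noise**: checks of weight `≤ w` (`w ≥ 2`), `1 ≤ d ≤` distance of this error type, any minimum-weight decoder,
`μ` locally stochastic of parameter `p ∈ [0,1]`, `r := 2(w-1)√p < 1`. Then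
`Σ_{E : decoding fails} μ E ≤ n r^d / ((w-1)(1-r))` (Gottesman 2014 Thm. 3's model, with the constant `w-1` in
place of the printed `ze`, `z = c(w-1)`). [cite: DumerKovalevPryadko2015, Thm 2 (y = 0; with Gottesman2014 Thm 3's local stochastic noise)] -/
theorem sum_decodingFails_le_of_rowWeight (H : Matrix (Fin m) (Fin n) (ZMod 2))
    (SX : Submodule (ZMod 2) (Fin n → ZMod 2)) {D : (Fin m → ZMod 2) → (Fin n → ZMod 2)}
    (hD : IsMinWeightDecoder H D) [DecidablePred (DecodingFails H SX D)]
    {w : ℕ} (hw : 2 ≤ w) (hrow : ∀ i, (rowSupp H i).card ≤ w) {d : ℕ} (hd1 : 1 ≤ d)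
    (hd : ∀ x : Fin n → ZMod 2, H *ᵥ x = 0 → x ∉ SX → d ≤ hammingNorm x)
    {μ : Finset (Fin n) → ℝ} {p : ℝ} (hμ : IsLocallyStochastic μ p) (hp0 : 0 ≤ p) (hp1 : p ≤ 1)
    (hr : 2 * ((w - 1 : ℕ) : ℝ) * Real.sqrt p < 1) :
    ∑ E ∈ univ.filter (fun E => DecodingFails H SX D E), μ E ≤
      (n : ℝ) * (2 * ((w - 1 : ℕ) : ℝ) * Real.sqrt p) ^ d /
        (((w - 1 : ℕ) : ℝ) * (1 - 2 * ((w - 1 : ℕ) : ℝ) * Real.sqrt p)) := by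
  classical
  set θ : ℝ := 2 * Real.sqrt p with hθ
  have hθ0 : 0 ≤ θ := by positivity
  have hr' : ((w - 1 : ℕ) : ℝ) * θ < 1 := by rw [hθ]; linarith
  set Ps : Finset (Finset (Fin n)) := univ.filter (fun W => IsIrreducible H W ∧ d ≤ W.card) with hPs
  have hcover : ∀ E ∈ univ.filter (fun E => DecodingFails H SX D E), ∃ W ∈ Ps,
      ((fun W : Finset (Fin n) => W) W).card ≤ 2 * ((fun W : Finset (Fin n) => W) W ∩ E).card := by
    intro E hE
    rw [mem_filter] at hE
    obtain ⟨W, hirr, hWS, hhalf⟩ := exists_irreducible_of_decodingFails H SX hD hE.2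
    refine ⟨W, ?_, hhalf⟩
    rw [hPs, mem_filter]
    exact ⟨mem_univ _, hirr, hirr.le_card hd hWS⟩
  have h1 := hμ.sum_le_sum_of_halfDense_cover hp0 hp1 Ps (fun W : Finset (Fin n) => W) _ hcover
  have h2 := sum_pow_card_irreducible_le H hw hrow hd1 hθ0 hr'
  rw [Fintype.card_fin] at h2
  have h3 : ((w - 1 : ℕ) : ℝ) * θ = 2 * ((w - 1 : ℕ) : ℝ) * Real.sqrt p := by rw [hθ]; ring
  rw [h3] at h2
  exact h1.trans h2

/-- **Counting-bound threshold with the irreducible-cluster constant, finite length, INDEPENDENT errors**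
(the printed channel): checks of weight `≤ w` (`w ≥ 2`), `1 ≤ d ≤` distance of this error type, any
minimum-weight decoder, each qubit in error independently with probability `0 ≤ p ≤ 1/2`,
`r := 2(w-1)√(p(1-p)) < 1` (i.e. `(w-1) Υ_CSS(0,p) < 1`). Then `Σ_{E : decoding fails} p^{|E|}(1-p)^{n-|E|} ≤
n r^d / ((w-1)(1-r))`. [cite: DumerKovalevPryadko2015, Thm 2 (y = 0: (w-1)·2√(p(1-p)) < 1)] -/
theorem sum_decodingFails_bernoulli_le_of_rowWeight (H : Matrix (Fin m) (Fin n) (ZMod 2))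
    (SX : Submodule (ZMod 2) (Fin n → ZMod 2)) {D : (Fin m → ZMod 2) → (Fin n → ZMod 2)}
    (hD : IsMinWeightDecoder H D) [DecidablePred (DecodingFails H SX D)]
    {w : ℕ} (hw : 2 ≤ w) (hrow : ∀ i, (rowSupp H i).card ≤ w) {d : ℕ} (hd1 : 1 ≤ d)
    (hd : ∀ x : Fin n → ZMod 2, H *ᵥ x = 0 → x ∉ SX → d ≤ hammingNorm x)
    {p : ℝ} (hp0 : 0 ≤ p) (hp : p ≤ 1 / 2)
    (hr : 2 * ((w - 1 : ℕ) : ℝ) * Real.sqrt (p * (1 - p)) < 1) :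
    ∑ E ∈ univ.filter (fun E => DecodingFails H SX D E), bernoulliWeight p E ≤
      (n : ℝ) * (2 * ((w - 1 : ℕ) : ℝ) * Real.sqrt (p * (1 - p))) ^ d /
        (((w - 1 : ℕ) : ℝ) * (1 - 2 * ((w - 1 : ℕ) : ℝ) * Real.sqrt (p * (1 - p)))) := by
  classical
  set θ : ℝ := 2 * Real.sqrt (p * (1 - p)) with hθ
  have hθ0 : 0 ≤ θ := by positivity
  have hr' : ((w - 1 : ℕ) : ℝ) * θ < 1 := by rw [hθ]; linarith
  set Ps : Finset (Finset (Fin n)) := univ.filter (fun W => IsIrreducible H W ∧ d ≤ W.card) with hPs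
  have hcover : ∀ E ∈ univ.filter (fun E => DecodingFails H SX D E), ∃ W ∈ Ps,
      ((fun W : Finset (Fin n) => W) W).card ≤ 2 * ((fun W : Finset (Fin n) => W) W ∩ E).card := by
    intro E hE
    rw [mem_filter] at hE
    obtain ⟨W, hirr, hWS, hhalf⟩ := exists_irreducible_of_decodingFails H SX hD hE.2
    refine ⟨W, ?_, hhalf⟩
    rw [hPs, mem_filter]
    exact ⟨mem_univ _, hirr, hirr.le_card hd hWS⟩
  have h1 := sum_bernoulliWeight_le_of_cover hp0 hp Ps (fun W : Finset (Fin n) => W) _ hcover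
  have h2 := sum_pow_card_irreducible_le H hw hrow hd1 hθ0 hr'
  rw [Fintype.card_fin] at h2
  have h3 : ((w - 1 : ℕ) : ℝ) * θ = 2 * ((w - 1 : ℕ) : ℝ) * Real.sqrt (p * (1 - p)) := by rw [hθ]; ring
  rw [h3] at h2
  exact h1.trans h2

end Decoding

/-! ### The threshold statement for code families -/

section Family

variable {n m : ℕ → ℕ}

open Classical in
/-- **DKP15 Theorem 2 at `y = 0` as a certified code-capacity threshold** (one error type, power-law-or-faster
distance): for a family of CSS codes with check weights `≤ w` (`w ≥ 2`), `1 ≤ d_i ≤` distance, minimum-weight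
decoders `D i`, and SIZE SUBEXPONENTIAL IN THE DISTANCE (`n_i r^{d_i} → 0` for every `0 < r < 1`), every
independent error rate `0 ≤ p ≤ 1/2` with `4(w-1)² p(1-p) < 1` is below threshold: the failure probability
`Σ_{E fails} p^{|E|}(1-p)^{n_i-|E|} → 0`. (For `w = 4`: `p < (3-2√2)/6 ≈ .0286`; for `w = 6`: `p(1-p) < 1/100`.)
[cite: DumerKovalevPryadko2015, Thm 2 (y = 0, power-law distance)] -/
theorem cssCodeCapacityThreshold_of_rowWeight (H : ∀ i, Matrix (Fin (m i)) (Fin (n i)) (ZMod 2))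
    (SX : ∀ i, Submodule (ZMod 2) (Fin (n i) → ZMod 2))
    (D : ∀ i, (Fin (m i) → ZMod 2) → (Fin (n i) → ZMod 2)) (hD : ∀ i, IsMinWeightDecoder (H i) (D i))
    {w : ℕ} (hw : 2 ≤ w) (hrow : ∀ i j, (rowSupp (H i) j).card ≤ w) (d : ℕ → ℕ) (hd1 : ∀ i, 1 ≤ d i)
    (hd : ∀ i (x : Fin (n i) → ZMod 2), H i *ᵥ x = 0 → x ∉ SX i → d i ≤ hammingNorm x)
    (hgrowth : ∀ r : ℝ, 0 < r → r < 1 → Tendsto (fun i => (n i : ℝ) * r ^ d i) atTop (𝓝 0))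
    {p : ℝ} (hp0 : 0 ≤ p) (hp : p ≤ 1 / 2) (h4 : 4 * ((w - 1 : ℕ) : ℝ) ^ 2 * (p * (1 - p)) < 1) :
    Tendsto (fun i => ∑ E ∈ univ.filter (fun E => DecodingFails (H i) (SX i) (D i) E),
      bernoulliWeight p E) atTop (𝓝 0) := by
  classical
  set K : ℝ := ((w - 1 : ℕ) : ℝ) with hK
  have hK1 : 1 ≤ K := by
    rw [hK]
    exact_mod_cast (show 1 ≤ w - 1 by omega)
  have hK0 : 0 < K := by linarith
  set s : ℝ := Real.sqrt (p * (1 - p)) with hs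
  set r : ℝ := 2 * K * s with hr
  have hs0 : 0 ≤ s := Real.sqrt_nonneg _
  have hr0 : 0 ≤ r := by positivity
  have hpp : 0 ≤ p * (1 - p) := mul_nonneg hp0 (by linarith)
  have hr1 : r < 1 := by
    have hsq : r ^ 2 = 4 * K ^ 2 * (p * (1 - p)) := by
      rw [hr, mul_pow, mul_pow, hs, Real.sq_sqrt hpp]
      ring
    have h : r ^ 2 < 1 := by rw [hsq]; exact h4
    have := (sq_lt_one_iff_abs_lt_one r).1 h
    rwa [abs_of_nonneg hr0] at this
  have h1r : 0 < 1 - r := by linarith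
  have hp1 : p ≤ 1 := by linarith
  have hbound : ∀ i, ∑ E ∈ univ.filter (fun E => DecodingFails (H i) (SX i) (D i) E), bernoulliWeight p E ≤
      (n i : ℝ) * r ^ d i / (K * (1 - r)) := fun i =>
    sum_decodingFails_bernoulli_le_of_rowWeight (H i) (SX i) (hD i) hw (hrow i) (hd1 i) (hd i) hp0 hp hr1
  have hnonneg : ∀ i, 0 ≤ ∑ E ∈ univ.filter (fun E => DecodingFails (H i) (SX i) (D i) E),
      bernoulliWeight p E := fun i => Finset.sum_nonneg fun E _ => bernoulliWeight_nonneg hp0 hp1 E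
  have hQ : Tendsto (fun i => (n i : ℝ) * r ^ d i / (K * (1 - r))) atTop (𝓝 0) := by
    rcases hr0.eq_or_lt with hr00 | hrpos
    · have : (fun i => (n i : ℝ) * r ^ d i / (K * (1 - r))) = fun _ => 0 := by
        funext i
        rw [← hr00, zero_pow (by have := hd1 i; omega)]
        simp
      rw [this]
      exact tendsto_const_nhds
    · have h := (hgrowth r hrpos hr1).div_const (K * (1 - r))
      simpa using h
  exact squeeze_zero hnonneg hbound hQ

end Family

end Literature.InformationTheory.QuantumCodes
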